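import Summits.AnomalousDissipation.AnomalousDissipation.Theorems.SawtoothPulseCascadeK1LocalisedCascadeSmoothLeakage

/-!
# K1loc, line `Spectral` / SeqCone — helper: SHIFT BOOKKEEPING for the two-branch fibre step

Helper file of the first prover lane on the crux `K1LocalisedCascade` (stmt-AnomalousDissipation-19491), route
`SawtoothPulseCascade` (memo `K1loc-architecture-findings-k1locp1.md`, recipe "S3a-final").  On a flat strip of slope `σ` the
fibre multiplier of a half-pulse is a CHARACTER `e_q` (exact affine transport, `q = ∓bₙ eⱼ`) times a slowly varying localiser
`Ξ`; weighted spectral energies of `e_q · F` are those of `F` for the SHIFTED symbol `k ↦ m(k + q)`, whose modulus of continuity is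
unchanged.  This file records that bookkeeping (reindexing `k ↦ k + q` of the lattice sums):

* `tsum_symbol_sq_mFourier_mul` — `∑ₖ m_k² ‖𝓕(e_q F)(k)‖² = ∑ₖ m_{k+q}² ‖𝓕F(k)‖²`;
* `tsum_symbol_sq_mFourier_mul_cross` — `∑ₖ m_k² 𝓕(e_{q₁}A)(k) conj(𝓕(e_{q₂}B)(k)) = ∑ₖ m_{k+q₁}² 𝓕A(k) conj(𝓕(e_{q₂−q₁}B)(k))`
  (the form in which `norm_tsum_symbol_sq_cross_le` applies to the two slope families: localisers `Ξ⁺` and `e_{q₂−q₁}Ξ⁻` are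
  still disjointly supported and `|e_{q₂−q₁}Ξ⁻| ≤ 1`);
* `modulus_shift` — the modulus hypothesis `|m k − m (k − n)| ≤ ω n` is invariant under `m ↦ m(· + q)`;
* `sqrt_tsum_symbol_sq_mFourier_mul_mul_le` — step (2) of the recipe assembled: `‖m(D)(e_q Ξ F)‖ ≤ ‖m(·+q)(D)F‖ + (∑ ω|𝓕Ξ|)‖F‖`.

WHAT THIS IS NOT: no statement about the cascade or the stub.  [cite: Grafakos2014, Prop. 3.1.2 (5) (coefficients of character multiples)]
[problem: turb]
-/

-- `Summit.<Summit>.<Problem>`: single-conjunct summit, the duplicate namespace segment is deliberate.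
set_option linter.dupNamespace false

noncomputable section

namespace Summit.AnomalousDissipation.AnomalousDissipation.Theorems.SawtoothPulseCascade.SpectralLeakage

open MeasureTheory Set Filter Topology UnitAddTorus Complex
open scoped ComplexConjugate
open Literature.Analysis Literature.Analysis.FunctionSpaces Literature.Analysis.FluidPDE
open Literature.Analysis.FunctionSpaces.Torus

variable {d : Type*} [Fintype d]

/-- **Shifted weighted energy**: `∑ₖ m_k² ‖𝓕(e_q F)(k)‖² = ∑ₖ m_{k+q}² ‖𝓕F(k)‖²` (shift rule and reindexing `k ↦ k + q`).
[cite: Grafakos2014, Prop. 3.1.2 (5) (coefficients of a character multiple)] -/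
theorem tsum_symbol_sq_mFourier_mul (F : UnitAddTorus d → ℂ) (q : d → ℤ) (m : (d → ℤ) → ℝ) :
    ∑' k, m k ^ 2 * ‖mFourierCoeff (fun x => mFourier q x * F x) k‖ ^ 2 =
      ∑' k, m (k + q) ^ 2 * ‖mFourierCoeff F k‖ ^ 2 := by
  rw [← (Equiv.addRight q).tsum_eq]
  refine tsum_congr fun k => ?_
  rw [Equiv.coe_addRight, mFourierCoeff_mFourier_mul, add_sub_cancel_right]

/-- **Shifted cross term**: `∑ₖ m_k² 𝓕(e_{q₁}A)(k) conj(𝓕(e_{q₂}B)(k)) = ∑ₖ m_{k+q₁}² 𝓕A(k) conj(𝓕(e_{q₂−q₁}B)(k))`.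
[cite: Grafakos2014, Prop. 3.1.2 (5) (coefficients of a character multiple)] -/
theorem tsum_symbol_sq_mFourier_mul_cross (A B : UnitAddTorus d → ℂ) (q₁ q₂ : d → ℤ) (m : (d → ℤ) → ℝ) :
    ∑' k, ((m k ^ 2 : ℝ) : ℂ) * mFourierCoeff (fun x => mFourier q₁ x * A x) k *
        conj (mFourierCoeff (fun x => mFourier q₂ x * B x) k) =
      ∑' k, ((m (k + q₁) ^ 2 : ℝ) : ℂ) * mFourierCoeff A k *
        conj (mFourierCoeff (fun x => mFourier (q₂ - q₁) x * B x) k) := by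
  rw [← (Equiv.addRight q₁).tsum_eq]
  refine tsum_congr fun k => ?_
  rw [Equiv.coe_addRight, mFourierCoeff_mFourier_mul, mFourierCoeff_mFourier_mul, mFourierCoeff_mFourier_mul,
    add_sub_cancel_right, show k + q₁ - q₂ = k - (q₂ - q₁) by abel]

omit [Fintype d] in
/-- The modulus hypothesis is invariant under shifting the symbol. [folklore] -/
theorem modulus_shift {m : (d → ℤ) → ℝ} {ω : (d → ℤ) → ℝ} (hω : ∀ k n, |m k - m (k - n)| ≤ ω n) (q : d → ℤ) :
    ∀ k n, |m (k + q) - m (k - n + q)| ≤ ω n := fun k n => by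
  have := hω (k + q) n
  rwa [show k + q - n = k - n + q by abel] at this

omit [Fintype d] in
/-- A bound on the symbol is invariant under shifting. [folklore] -/
theorem bound_shift {m : (d → ℤ) → ℝ} {M : ℝ} (hmM : ∀ k, |m k| ≤ M) (q : d → ℤ) : ∀ k, |m (k + q)| ≤ M :=
  fun k => hmM (k + q)

/-- **Step (2) of the two-branch recipe**: for `F, Ξ` continuous with summable coefficients, `‖Ξ‖ ≤ 1`, a character `e_q` and a
bounded real symbol `m` with modulus `ω` (`∑ ω‖𝓕Ξ‖ < ∞`):
`√(∑ₖ m_k²‖𝓕(e_q Ξ F)(k)‖²) ≤ √(∑ₖ m_{k+q}²‖𝓕F(k)‖²) + (∑ₙ ω n ‖𝓕Ξ n‖)·√(∫‖F‖²)` — the exact affine transport shifts the symbol,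
the localiser leaks by its first `ω`-moment. [cite: Grafakos2014, Prop. 3.1.2 (5) and Prop. 3.2.7 (3)] -/
theorem sqrt_tsum_symbol_sq_mFourier_mul_mul_le {F Ξ : UnitAddTorus d → ℂ} (hF : Continuous F)
    (hFs : Summable fun k => ‖mFourierCoeff F k‖) (hΞ : Continuous Ξ)
    (hΞs : Summable fun k => ‖mFourierCoeff Ξ k‖) (hΞ1 : ∀ x, ‖Ξ x‖ ≤ 1) (q : d → ℤ)
    {m : (d → ℤ) → ℝ} {M : ℝ} (hmM : ∀ k, |m k| ≤ M) {ω : (d → ℤ) → ℝ} (hω0 : ∀ n, 0 ≤ ω n)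
    (hω : ∀ k n, |m k - m (k - n)| ≤ ω n) (hωs : Summable fun n => ω n * ‖mFourierCoeff Ξ n‖) :
    Real.sqrt (∑' k, m k ^ 2 * ‖mFourierCoeff (fun x => mFourier q x * (Ξ x * F x)) k‖ ^ 2) ≤
      Real.sqrt (∑' k, m (k + q) ^ 2 * ‖mFourierCoeff F k‖ ^ 2) +
        (∑' n, ω n * ‖mFourierCoeff Ξ n‖) * Real.sqrt (∫ x, ‖F x‖ ^ 2) := by
  rw [tsum_symbol_sq_mFourier_mul (fun x => Ξ x * F x) q m]
  exact sqrt_tsum_symbol_sq_mul_le (m := fun k => m (k + q)) hF hFs hΞ hΞs hΞ1 (bound_shift hmM q) hω0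
    (modulus_shift hω q) hωs

/-! ## §2 The two-branch fibre step, assembled (cross term and zone remainder as inputs)

`tsum_symbol_sq_norm_add` and `sqrt_tsum_symbol_sq_two_branch_le`: if the transported fibre is
`H = e_{q⁺}Ξ⁺F + e_{q⁻}Ξ⁻F + E` then
`‖m(D)H‖ ≤ √((‖m(·+q⁺)(D)F‖ + A⁺‖F‖)² + (‖m(·+q⁻)(D)F‖ + A⁻‖F‖)² + 2c) + M‖E‖`, with the cross bound `c` as input
(supplied by `norm_tsum_symbol_sq_cross_le` of `…SpectralCommutator` after `tsum_symbol_sq_mFourier_mul_cross`) and the zone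
remainder `E` charged by its `L²` norm — the energy recursion `m_before² = m(·+q⁺)² + m(·+q⁻)²` of memo F-a / NET S3e. -/

omit [Fintype d] in
/-- `‖a + b‖² = ‖a‖² + ‖b‖² + 2 Re(a conj b)` in `ℂ`. [folklore] -/
theorem norm_add_sq_complex (a b : ℂ) : ‖a + b‖ ^ 2 = ‖a‖ ^ 2 + ‖b‖ ^ 2 + 2 * (a * conj b).re := by
  rw [Complex.sq_norm, Complex.sq_norm, Complex.sq_norm, Complex.normSq_add]

omit [Fintype d] in
/-- **Weighted energy of a sum of two pieces**: for square-summable weighted families,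
`∑ₖ m_k²‖a_k + b_k‖² = ∑ₖ m_k²‖a_k‖² + ∑ₖ m_k²‖b_k‖² + 2 Re ∑ₖ m_k² a_k conj(b_k)`. [folklore] -/
theorem tsum_symbol_sq_norm_add {a b : (d → ℤ) → ℂ} {m : (d → ℤ) → ℝ}
    (ha : Summable fun k => m k ^ 2 * ‖a k‖ ^ 2) (hb : Summable fun k => m k ^ 2 * ‖b k‖ ^ 2)
    (hab : Summable fun k => ((m k ^ 2 : ℝ) : ℂ) * a k * conj (b k)) :
    (Summable fun k => m k ^ 2 * ‖a k + b k‖ ^ 2) ∧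
    ∑' k, m k ^ 2 * ‖a k + b k‖ ^ 2 =
      ∑' k, m k ^ 2 * ‖a k‖ ^ 2 + ∑' k, m k ^ 2 * ‖b k‖ ^ 2 +
        2 * (∑' k, ((m k ^ 2 : ℝ) : ℂ) * a k * conj (b k)).re := by
  have hre : HasSum (fun k => (((m k ^ 2 : ℝ) : ℂ) * a k * conj (b k)).re)
      (∑' k, ((m k ^ 2 : ℝ) : ℂ) * a k * conj (b k)).re := Complex.reCLM.hasSum hab.hasSum
  have hpt : ∀ k, m k ^ 2 * ‖a k + b k‖ ^ 2 =
      m k ^ 2 * ‖a k‖ ^ 2 + m k ^ 2 * ‖b k‖ ^ 2 + 2 * (((m k ^ 2 : ℝ) : ℂ) * a k * conj (b k)).re := fun k => by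
    rw [norm_add_sq_complex, mul_assoc, Complex.re_ofReal_mul]
    ring
  have hsum := (ha.hasSum.add hb.hasSum).add (hre.mul_left 2)
  have hsum' : HasSum (fun k => m k ^ 2 * ‖a k + b k‖ ^ 2)
      (∑' k, m k ^ 2 * ‖a k‖ ^ 2 + ∑' k, m k ^ 2 * ‖b k‖ ^ 2 +
        2 * (∑' k, ((m k ^ 2 : ℝ) : ℂ) * a k * conj (b k)).re) :=
    hsum.congr_fun fun k => hpt k
  exact ⟨hsum'.summable, hsum'.tsum_eq⟩

/-- **The two-branch fibre step, assembled.**  Let `F` (the fibre function), `Ξ⁺, Ξ⁻` (the slope localisers, `‖Ξ^±‖ ≤ 1`)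
and `E` (the zone remainder) be continuous with summable coefficients where needed, `q⁺, q⁻` the two exact shifts, and suppose
the transported fibre is `H = e_{q⁺}Ξ⁺F + e_{q⁻}Ξ⁻F + E`.  Let `m` be a real symbol (`|m| ≤ M`, modulus `ω`,
`∑ ω‖𝓕Ξ^±‖ < ∞`), and let `c` bound the cross term `|∑ₖ m_k² 𝓕(e_{q⁺}Ξ⁺F)(k) conj 𝓕(e_{q⁻}Ξ⁻F)(k)| ≤ c`
(`norm_tsum_symbol_sq_cross_le` after `tsum_symbol_sq_mFourier_mul_cross`).  Then
`‖m(D)H‖ ≤ √((‖m(·+q⁺)(D)F‖ + A⁺‖F‖)² + (‖m(·+q⁻)(D)F‖ + A⁻‖F‖)² + 2c) + M‖E‖`,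
with `A^± = ∑ₙ ω n ‖𝓕Ξ^± n‖` — the energy recursion `m_before² = m(·+q⁺)² + m(·+q⁻)²` of the line up to leakage, cross
term and zone charge. [cite: Grafakos2014, Prop. 3.1.2 (5) and Prop. 3.2.7 (3)] -/
theorem sqrt_tsum_symbol_sq_two_branch_le {F Ξp Ξm E H : UnitAddTorus d → ℂ} (hF : Continuous F)
    (hFs : Summable fun k => ‖mFourierCoeff F k‖) (hΞp : Continuous Ξp) (hΞps : Summable fun k => ‖mFourierCoeff Ξp k‖)
    (hΞp1 : ∀ x, ‖Ξp x‖ ≤ 1) (hΞm : Continuous Ξm) (hΞms : Summable fun k => ‖mFourierCoeff Ξm k‖)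
    (hΞm1 : ∀ x, ‖Ξm x‖ ≤ 1) (hE : Continuous E) (qp qm : d → ℤ)
    (hH : H = fun x => mFourier qp x * (Ξp x * F x) + mFourier qm x * (Ξm x * F x) + E x)
    {m : (d → ℤ) → ℝ} {M : ℝ} (hmM : ∀ k, |m k| ≤ M) {ω : (d → ℤ) → ℝ} (hω0 : ∀ n, 0 ≤ ω n)
    (hω : ∀ k n, |m k - m (k - n)| ≤ ω n) (hωp : Summable fun n => ω n * ‖mFourierCoeff Ξp n‖)
    (hωm : Summable fun n => ω n * ‖mFourierCoeff Ξm n‖) {c : ℝ}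
    (hc : ‖∑' k, ((m k ^ 2 : ℝ) : ℂ) * mFourierCoeff (fun x => mFourier qp x * (Ξp x * F x)) k *
        conj (mFourierCoeff (fun x => mFourier qm x * (Ξm x * F x)) k)‖ ≤ c) :
    Real.sqrt (∑' k, m k ^ 2 * ‖mFourierCoeff H k‖ ^ 2) ≤
      Real.sqrt ((Real.sqrt (∑' k, m (k + qp) ^ 2 * ‖mFourierCoeff F k‖ ^ 2) +
            (∑' n, ω n * ‖mFourierCoeff Ξp n‖) * Real.sqrt (∫ x, ‖F x‖ ^ 2)) ^ 2 +
          (Real.sqrt (∑' k, m (k + qm) ^ 2 * ‖mFourierCoeff F k‖ ^ 2) +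
            (∑' n, ω n * ‖mFourierCoeff Ξm n‖) * Real.sqrt (∫ x, ‖F x‖ ^ 2)) ^ 2 + 2 * c) +
        M * Real.sqrt (∫ x, ‖E x‖ ^ 2) := by
  classical
  have hM0 : 0 ≤ M := (abs_nonneg _).trans (hmM 0)
  have hm2 : ∀ k, m k ^ 2 ≤ M ^ 2 := fun k => by
    rw [← sq_abs]; exact pow_le_pow_left₀ (abs_nonneg _) (hmM k) 2
  -- the two transported pieces and their coefficient families
  set Pp : UnitAddTorus d → ℂ := fun x => mFourier qp x * (Ξp x * F x) with hPp
  set Pm : UnitAddTorus d → ℂ := fun x => mFourier qm x * (Ξm x * F x) with hPm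
  have hPp_c : Continuous Pp := (mFourier qp).continuous.mul (hΞp.mul hF)
  have hPm_c : Continuous Pm := (mFourier qm).continuous.mul (hΞm.mul hF)
  set a : (d → ℤ) → ℂ := fun k => mFourierCoeff Pp k with ha_def
  set b : (d → ℤ) → ℂ := fun k => mFourierCoeff Pm k with hb_def
  set e : (d → ℤ) → ℂ := fun k => mFourierCoeff E k with he_def
  -- coefficients of `H`
  have hcoeff : ∀ k, mFourierCoeff H k = (a k + b k) + e k := fun k => by
    rw [hH, show (fun x => mFourier qp x * (Ξp x * F x) + mFourier qm x * (Ξm x * F x) + E x) = (Pp + Pm) + E by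
      funext x; simp [hPp, hPm]]
    rw [mFourierCoeff_add (hPp_c.add hPm_c).integrable_unitAddTorus hE.integrable_unitAddTorus,
      mFourierCoeff_add hPp_c.integrable_unitAddTorus hPm_c.integrable_unitAddTorus]
  -- weighted summabilities (bounded symbol × Parseval)
  have wsum : ∀ {G : UnitAddTorus d → ℂ}, Continuous G → Summable fun k => m k ^ 2 * ‖mFourierCoeff G k‖ ^ 2 :=
    fun hG => ((hasSum_sq_mFourierCoeff_of_continuous hG).summable.mul_left (M ^ 2)).of_nonneg_of_le
      (fun k => by positivity) fun k => mul_le_mul_of_nonneg_right (hm2 k) (sq_nonneg _)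
  have hsa : Summable fun k => m k ^ 2 * ‖a k‖ ^ 2 := wsum hPp_c
  have hsb : Summable fun k => m k ^ 2 * ‖b k‖ ^ 2 := wsum hPm_c
  have hse : Summable fun k => m k ^ 2 * ‖e k‖ ^ 2 := wsum hE
  -- the cross family is summable (`|m² a b̄| ≤ m²(|a|² + |b|²)/2`)
  have hsab : Summable fun k => ((m k ^ 2 : ℝ) : ℂ) * a k * conj (b k) := by
    refine .of_norm <| ((hsa.add hsb).div_const 2).of_nonneg_of_le (fun _ => norm_nonneg _) fun k => ?_
    rw [norm_mul, norm_mul, Complex.norm_real, RCLike.norm_conj, Real.norm_eq_abs, abs_of_nonneg (sq_nonneg _)]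
    have h2 : 0 ≤ m k ^ 2 := sq_nonneg _
    nlinarith [sq_nonneg (‖a k‖ - ‖b k‖), mul_nonneg h2 (sq_nonneg (‖a k‖ - ‖b k‖))]
  -- (i) Minkowski: split off the zone remainder
  obtain ⟨hsab2, hab_eq⟩ := tsum_symbol_sq_norm_add hsa hsb hsab
  have hab0 : ∀ k, 0 ≤ |m k| * ‖a k + b k‖ := fun k => mul_nonneg (abs_nonneg _) (norm_nonneg _)
  have he0 : ∀ k, 0 ≤ |m k| * ‖e k‖ := fun k => mul_nonneg (abs_nonneg _) (norm_nonneg _)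
  have hsab2' : Summable fun k => (|m k| * ‖a k + b k‖) ^ 2 := by
    refine hsab2.congr fun k => ?_; rw [mul_pow, sq_abs]
  have hse' : Summable fun k => (|m k| * ‖e k‖) ^ 2 := by
    refine hse.congr fun k => ?_; rw [mul_pow, sq_abs]
  obtain ⟨-, hMink⟩ := sqrt_tsum_add_sq_le hab0 he0 hsab2' hse'
  have hLHS : ∑' k, m k ^ 2 * ‖mFourierCoeff H k‖ ^ 2 ≤ ∑' k, (|m k| * ‖a k + b k‖ + |m k| * ‖e k‖) ^ 2 := by
    have hs3 : Summable fun k => (|m k| * ‖a k + b k‖ + |m k| * ‖e k‖) ^ 2 :=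
      (sqrt_tsum_add_sq_le hab0 he0 hsab2' hse').1
    refine Summable.tsum_le_tsum (fun k => ?_) ?_ hs3
    · rw [hcoeff k, ← sq_abs (m k), ← mul_pow, ← mul_add]
      exact pow_le_pow_left₀ (mul_nonneg (abs_nonneg _) (norm_nonneg _))
        (mul_le_mul_of_nonneg_left (norm_add_le _ _) (abs_nonneg _)) 2
    · exact hs3.of_nonneg_of_le (fun k => by positivity) fun k => by
        rw [hcoeff k, ← sq_abs (m k), ← mul_pow, ← mul_add]
        exact pow_le_pow_left₀ (mul_nonneg (abs_nonneg _) (norm_nonneg _))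
          (mul_le_mul_of_nonneg_left (norm_add_le _ _) (abs_nonneg _)) 2
  -- (ii) the zone remainder: `√(∑ m²‖e‖²) ≤ M ‖E‖`
  have hParsE := hasSum_sq_mFourierCoeff_of_continuous hE
  have hEterm : Real.sqrt (∑' k, (|m k| * ‖e k‖) ^ 2) ≤ M * Real.sqrt (∫ x, ‖E x‖ ^ 2) := by
    have h1 : ∑' k, (|m k| * ‖e k‖) ^ 2 ≤ M ^ 2 * ∫ x, ‖E x‖ ^ 2 := by
      rw [← hParsE.tsum_eq, ← tsum_mul_left]
      refine hse'.tsum_le_tsum (fun k => ?_) (hParsE.summable.mul_left _)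
      rw [mul_pow, sq_abs]
      exact mul_le_mul_of_nonneg_right (hm2 k) (sq_nonneg _)
    calc Real.sqrt (∑' k, (|m k| * ‖e k‖) ^ 2) ≤ Real.sqrt (M ^ 2 * ∫ x, ‖E x‖ ^ 2) := Real.sqrt_le_sqrt h1
      _ = M * Real.sqrt (∫ x, ‖E x‖ ^ 2) := by
          rw [Real.sqrt_mul' _ (integral_nonneg fun x => by positivity), Real.sqrt_sq hM0]
  -- (iii) the two branches: energies add up to the cross term
  have hstep_p := sqrt_tsum_symbol_sq_mFourier_mul_mul_le hF hFs hΞp hΞps hΞp1 qp hmM hω0 hω hωp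
  have hstep_m := sqrt_tsum_symbol_sq_mFourier_mul_mul_le hF hFs hΞm hΞms hΞm1 qm hmM hω0 hω hωm
  have ha_le : ∑' k, m k ^ 2 * ‖a k‖ ^ 2 ≤ (Real.sqrt (∑' k, m (k + qp) ^ 2 * ‖mFourierCoeff F k‖ ^ 2) +
      (∑' n, ω n * ‖mFourierCoeff Ξp n‖) * Real.sqrt (∫ x, ‖F x‖ ^ 2)) ^ 2 := by
    have h0 : 0 ≤ ∑' k, m k ^ 2 * ‖a k‖ ^ 2 := tsum_nonneg fun k => by positivity
    calc ∑' k, m k ^ 2 * ‖a k‖ ^ 2 = (Real.sqrt (∑' k, m k ^ 2 * ‖a k‖ ^ 2)) ^ 2 := (Real.sq_sqrt h0).symm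
      _ ≤ _ := pow_le_pow_left₀ (Real.sqrt_nonneg _) hstep_p 2
  have hb_le : ∑' k, m k ^ 2 * ‖b k‖ ^ 2 ≤ (Real.sqrt (∑' k, m (k + qm) ^ 2 * ‖mFourierCoeff F k‖ ^ 2) +
      (∑' n, ω n * ‖mFourierCoeff Ξm n‖) * Real.sqrt (∫ x, ‖F x‖ ^ 2)) ^ 2 := by
    have h0 : 0 ≤ ∑' k, m k ^ 2 * ‖b k‖ ^ 2 := tsum_nonneg fun k => by positivity
    calc ∑' k, m k ^ 2 * ‖b k‖ ^ 2 = (Real.sqrt (∑' k, m k ^ 2 * ‖b k‖ ^ 2)) ^ 2 := (Real.sq_sqrt h0).symm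
      _ ≤ _ := pow_le_pow_left₀ (Real.sqrt_nonneg _) hstep_m 2
  have hcross : 2 * (∑' k, ((m k ^ 2 : ℝ) : ℂ) * a k * conj (b k)).re ≤ 2 * c := by
    have := (Complex.re_le_norm _).trans hc
    linarith
  have hbranches : ∑' k, (|m k| * ‖a k + b k‖) ^ 2 ≤
      (Real.sqrt (∑' k, m (k + qp) ^ 2 * ‖mFourierCoeff F k‖ ^ 2) +
          (∑' n, ω n * ‖mFourierCoeff Ξp n‖) * Real.sqrt (∫ x, ‖F x‖ ^ 2)) ^ 2 +
        (Real.sqrt (∑' k, m (k + qm) ^ 2 * ‖mFourierCoeff F k‖ ^ 2) +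
          (∑' n, ω n * ‖mFourierCoeff Ξm n‖) * Real.sqrt (∫ x, ‖F x‖ ^ 2)) ^ 2 + 2 * c := by
    have heq : ∑' k, (|m k| * ‖a k + b k‖) ^ 2 = ∑' k, m k ^ 2 * ‖a k + b k‖ ^ 2 :=
      tsum_congr fun k => by rw [mul_pow, sq_abs]
    rw [heq, hab_eq]
    linarith
  -- assemble
  calc Real.sqrt (∑' k, m k ^ 2 * ‖mFourierCoeff H k‖ ^ 2)
      ≤ Real.sqrt (∑' k, (|m k| * ‖a k + b k‖ + |m k| * ‖e k‖) ^ 2) := Real.sqrt_le_sqrt hLHS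
    _ ≤ Real.sqrt (∑' k, (|m k| * ‖a k + b k‖) ^ 2) + Real.sqrt (∑' k, (|m k| * ‖e k‖) ^ 2) := hMink
    _ ≤ _ := add_le_add (Real.sqrt_le_sqrt hbranches) hEterm

/-! ## §3 Three pieces: the zone remainder as a localised piece (energies add; all cross terms as inputs)

`tsum_symbol_sq_three_piece_le`: with `H = e_{q⁺}Ξ⁺F + e_{q⁻}Ξ⁻F + E` as in §2 but the zone remainder `E` treated as a
THIRD piece whose cross terms with the two branches are also inputs (`c₊`, `c₋`; in the line they are commutators plus thin
transition-layer overlaps, memo F-c/F-g), the weighted energies ADD: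
`∑ m²‖𝓕H‖² ≤ X₊² + X₋² + M²‖E‖² + 2(c + c₊ + c₋)` — the zone charge enters as an ENERGY `M²‖E‖²`, not as an amplitude
(the amplitude form of §2 is what memo F-c shows to be unaffordable over the cascade: `∑ⱼ √(2ηⱼ) ≈ 2.2`). -/

/-- **The three-piece fibre step (energy form).**  Hypotheses as in `sqrt_tsum_symbol_sq_two_branch_le`, plus bounds `c₊, c₋` on
the cross terms of the zone remainder `E` with the two branches.  Then
`∑ₖ m_k²‖𝓕H(k)‖² ≤ X₊² + X₋² + M² ∫‖E‖² + 2(c + c₊ + c₋)` with `X^± = ‖m(·+q^±)(D)F‖ + A^±‖F‖`.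
[cite: Grafakos2014, Prop. 3.1.2 (5) and Prop. 3.2.7 (3)] -/
theorem tsum_symbol_sq_three_piece_le {F Ξp Ξm E H : UnitAddTorus d → ℂ} (hF : Continuous F)
    (hFs : Summable fun k => ‖mFourierCoeff F k‖) (hΞp : Continuous Ξp) (hΞps : Summable fun k => ‖mFourierCoeff Ξp k‖)
    (hΞp1 : ∀ x, ‖Ξp x‖ ≤ 1) (hΞm : Continuous Ξm) (hΞms : Summable fun k => ‖mFourierCoeff Ξm k‖)
    (hΞm1 : ∀ x, ‖Ξm x‖ ≤ 1) (hE : Continuous E) (qp qm : d → ℤ)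
    (hH : H = fun x => mFourier qp x * (Ξp x * F x) + mFourier qm x * (Ξm x * F x) + E x)
    {m : (d → ℤ) → ℝ} {M : ℝ} (hmM : ∀ k, |m k| ≤ M) {ω : (d → ℤ) → ℝ} (hω0 : ∀ n, 0 ≤ ω n)
    (hω : ∀ k n, |m k - m (k - n)| ≤ ω n) (hωp : Summable fun n => ω n * ‖mFourierCoeff Ξp n‖)
    (hωm : Summable fun n => ω n * ‖mFourierCoeff Ξm n‖) {c cp cm : ℝ}
    (hc : ‖∑' k, ((m k ^ 2 : ℝ) : ℂ) * mFourierCoeff (fun x => mFourier qp x * (Ξp x * F x)) k *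
        conj (mFourierCoeff (fun x => mFourier qm x * (Ξm x * F x)) k)‖ ≤ c)
    (hcp : ‖∑' k, ((m k ^ 2 : ℝ) : ℂ) * mFourierCoeff (fun x => mFourier qp x * (Ξp x * F x)) k *
        conj (mFourierCoeff E k)‖ ≤ cp)
    (hcm : ‖∑' k, ((m k ^ 2 : ℝ) : ℂ) * mFourierCoeff (fun x => mFourier qm x * (Ξm x * F x)) k *
        conj (mFourierCoeff E k)‖ ≤ cm) :
    ∑' k, m k ^ 2 * ‖mFourierCoeff H k‖ ^ 2 ≤
      (Real.sqrt (∑' k, m (k + qp) ^ 2 * ‖mFourierCoeff F k‖ ^ 2) +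
          (∑' n, ω n * ‖mFourierCoeff Ξp n‖) * Real.sqrt (∫ x, ‖F x‖ ^ 2)) ^ 2 +
        (Real.sqrt (∑' k, m (k + qm) ^ 2 * ‖mFourierCoeff F k‖ ^ 2) +
          (∑' n, ω n * ‖mFourierCoeff Ξm n‖) * Real.sqrt (∫ x, ‖F x‖ ^ 2)) ^ 2 +
        M ^ 2 * (∫ x, ‖E x‖ ^ 2) + 2 * (c + cp + cm) := by
  classical
  have hM0 : 0 ≤ M := (abs_nonneg _).trans (hmM 0)
  have hm2 : ∀ k, m k ^ 2 ≤ M ^ 2 := fun k => by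
    rw [← sq_abs]; exact pow_le_pow_left₀ (abs_nonneg _) (hmM k) 2
  set Pp : UnitAddTorus d → ℂ := fun x => mFourier qp x * (Ξp x * F x) with hPp
  set Pm : UnitAddTorus d → ℂ := fun x => mFourier qm x * (Ξm x * F x) with hPm
  have hPp_c : Continuous Pp := (mFourier qp).continuous.mul (hΞp.mul hF)
  have hPm_c : Continuous Pm := (mFourier qm).continuous.mul (hΞm.mul hF)
  set a : (d → ℤ) → ℂ := fun k => mFourierCoeff Pp k with ha_def
  set b : (d → ℤ) → ℂ := fun k => mFourierCoeff Pm k with hb_def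
  set e : (d → ℤ) → ℂ := fun k => mFourierCoeff E k with he_def
  have hcoeff : ∀ k, mFourierCoeff H k = (a k + b k) + e k := fun k => by
    rw [hH, show (fun x => mFourier qp x * (Ξp x * F x) + mFourier qm x * (Ξm x * F x) + E x) = (Pp + Pm) + E by
      funext x; simp [hPp, hPm]]
    rw [mFourierCoeff_add (hPp_c.add hPm_c).integrable_unitAddTorus hE.integrable_unitAddTorus,
      mFourierCoeff_add hPp_c.integrable_unitAddTorus hPm_c.integrable_unitAddTorus]
  -- weighted summabilities
  have wsum : ∀ {G : UnitAddTorus d → ℂ}, Continuous G → Summable fun k => m k ^ 2 * ‖mFourierCoeff G k‖ ^ 2 :=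
    fun hG => ((hasSum_sq_mFourierCoeff_of_continuous hG).summable.mul_left (M ^ 2)).of_nonneg_of_le
      (fun k => by positivity) fun k => mul_le_mul_of_nonneg_right (hm2 k) (sq_nonneg _)
  have hsa : Summable fun k => m k ^ 2 * ‖a k‖ ^ 2 := wsum hPp_c
  have hsb : Summable fun k => m k ^ 2 * ‖b k‖ ^ 2 := wsum hPm_c
  have hse : Summable fun k => m k ^ 2 * ‖e k‖ ^ 2 := wsum hE
  have hsab_sum : Summable fun k => m k ^ 2 * ‖a k + b k‖ ^ 2 := by
    have := wsum (hPp_c.add hPm_c)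
    refine this.congr fun k => ?_
    rw [mFourierCoeff_add hPp_c.integrable_unitAddTorus hPm_c.integrable_unitAddTorus]
  -- cross families are summable (`|m² u v̄| ≤ m²(|u|² + |v|²)/2`)
  have cross_summable : ∀ {u v : (d → ℤ) → ℂ}, (Summable fun k => m k ^ 2 * ‖u k‖ ^ 2) →
      (Summable fun k => m k ^ 2 * ‖v k‖ ^ 2) → Summable fun k => ((m k ^ 2 : ℝ) : ℂ) * u k * conj (v k) := by
    intro u v hu hv
    refine .of_norm <| ((hu.add hv).div_const 2).of_nonneg_of_le (fun _ => norm_nonneg _) fun k => ?_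
    rw [norm_mul, norm_mul, Complex.norm_real, RCLike.norm_conj, Real.norm_eq_abs, abs_of_nonneg (sq_nonneg _)]
    have h2 : 0 ≤ m k ^ 2 := sq_nonneg _
    nlinarith [sq_nonneg (‖u k‖ - ‖v k‖), mul_nonneg h2 (sq_nonneg (‖u k‖ - ‖v k‖))]
  have hsab : Summable fun k => ((m k ^ 2 : ℝ) : ℂ) * a k * conj (b k) := cross_summable hsa hsb
  have hsae : Summable fun k => ((m k ^ 2 : ℝ) : ℂ) * a k * conj (e k) := cross_summable hsa hse
  have hsbe : Summable fun k => ((m k ^ 2 : ℝ) : ℂ) * b k * conj (e k) := cross_summable hsb hse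
  have hsabe : Summable fun k => ((m k ^ 2 : ℝ) : ℂ) * (a k + b k) * conj (e k) := cross_summable hsab_sum hse
  -- expand `‖(a+b)+e‖²` and `‖a+b‖²`
  obtain ⟨-, h1⟩ := tsum_symbol_sq_norm_add hsab_sum hse hsabe
  obtain ⟨-, h2⟩ := tsum_symbol_sq_norm_add hsa hsb hsab
  have hlin : ∑' k, ((m k ^ 2 : ℝ) : ℂ) * (a k + b k) * conj (e k) =
      ∑' k, ((m k ^ 2 : ℝ) : ℂ) * a k * conj (e k) + ∑' k, ((m k ^ 2 : ℝ) : ℂ) * b k * conj (e k) := by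
    rw [← hsae.tsum_add hsbe]
    exact tsum_congr fun k => by ring
  have hH_eq : ∑' k, m k ^ 2 * ‖mFourierCoeff H k‖ ^ 2 = ∑' k, m k ^ 2 * ‖(a k + b k) + e k‖ ^ 2 :=
    tsum_congr fun k => by rw [hcoeff k]
  -- the individual bounds
  have hstep_p := sqrt_tsum_symbol_sq_mFourier_mul_mul_le hF hFs hΞp hΞps hΞp1 qp hmM hω0 hω hωp
  have hstep_m := sqrt_tsum_symbol_sq_mFourier_mul_mul_le hF hFs hΞm hΞms hΞm1 qm hmM hω0 hω hωm
  have ha_le : ∑' k, m k ^ 2 * ‖a k‖ ^ 2 ≤ (Real.sqrt (∑' k, m (k + qp) ^ 2 * ‖mFourierCoeff F k‖ ^ 2) +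
      (∑' n, ω n * ‖mFourierCoeff Ξp n‖) * Real.sqrt (∫ x, ‖F x‖ ^ 2)) ^ 2 := by
    have h0 : 0 ≤ ∑' k, m k ^ 2 * ‖a k‖ ^ 2 := tsum_nonneg fun k => by positivity
    calc ∑' k, m k ^ 2 * ‖a k‖ ^ 2 = (Real.sqrt (∑' k, m k ^ 2 * ‖a k‖ ^ 2)) ^ 2 := (Real.sq_sqrt h0).symm
      _ ≤ _ := pow_le_pow_left₀ (Real.sqrt_nonneg _) hstep_p 2
  have hb_le : ∑' k, m k ^ 2 * ‖b k‖ ^ 2 ≤ (Real.sqrt (∑' k, m (k + qm) ^ 2 * ‖mFourierCoeff F k‖ ^ 2) +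
      (∑' n, ω n * ‖mFourierCoeff Ξm n‖) * Real.sqrt (∫ x, ‖F x‖ ^ 2)) ^ 2 := by
    have h0 : 0 ≤ ∑' k, m k ^ 2 * ‖b k‖ ^ 2 := tsum_nonneg fun k => by positivity
    calc ∑' k, m k ^ 2 * ‖b k‖ ^ 2 = (Real.sqrt (∑' k, m k ^ 2 * ‖b k‖ ^ 2)) ^ 2 := (Real.sq_sqrt h0).symm
      _ ≤ _ := pow_le_pow_left₀ (Real.sqrt_nonneg _) hstep_m 2
  have hParsE := hasSum_sq_mFourierCoeff_of_continuous hE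
  have he_le : ∑' k, m k ^ 2 * ‖e k‖ ^ 2 ≤ M ^ 2 * ∫ x, ‖E x‖ ^ 2 := by
    rw [← hParsE.tsum_eq, ← tsum_mul_left]
    exact hse.tsum_le_tsum (fun k => mul_le_mul_of_nonneg_right (hm2 k) (sq_nonneg _)) (hParsE.summable.mul_left _)
  have hre1 : (∑' k, ((m k ^ 2 : ℝ) : ℂ) * a k * conj (b k)).re ≤ c := (Complex.re_le_norm _).trans hc
  have hre2 : (∑' k, ((m k ^ 2 : ℝ) : ℂ) * a k * conj (e k)).re ≤ cp := (Complex.re_le_norm _).trans hcp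
  have hre3 : (∑' k, ((m k ^ 2 : ℝ) : ℂ) * b k * conj (e k)).re ≤ cm := (Complex.re_le_norm _).trans hcm
  rw [hH_eq, h1, h2, hlin, Complex.add_re]
  have h2c : 2 * (∑' k, ((m k ^ 2 : ℝ) : ℂ) * a k * conj (b k)).re ≤ 2 * c :=
    mul_le_mul_of_nonneg_left hre1 (by norm_num)
  have h2e : 2 * ((∑' k, ((m k ^ 2 : ℝ) : ℂ) * a k * conj (e k)).re +
      (∑' k, ((m k ^ 2 : ℝ) : ℂ) * b k * conj (e k)).re) ≤ 2 * (cp + cm) :=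
    mul_le_mul_of_nonneg_left (add_le_add hre2 hre3) (by norm_num)
  have htot := add_le_add (add_le_add (add_le_add (add_le_add ha_le hb_le) h2c) he_le) h2e
  refine htot.trans (le_of_eq ?_)
  ring

end Summit.AnomalousDissipation.AnomalousDissipation.Theorems.SawtoothPulseCascade.SpectralLeakage
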